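import Summits.AtomisticToContinuum.Crystallization.Theorems.ExcessDecayLiouvilleSiteGeometry

/-!
# Route `ExcessDecayLiouville`: the particle–site matching behind a two-way `ε`-matching

First step of any excess-decay / Liouville argument for item `ExcessDecay` (stmt-AtomisticToContinuum-9334)
and crux `HcpLiouville`: if a `δ`-separated set `X` is two-way `ε`-matched with the site set of an
admissible datum `(t, A)` (hcp-like inner displacement) on the ball `dist · c ≤ r`, and the tolerance is
small (`2ε < δ`, `ε < 23/50`), then the matching is a partial BIJECTION moving points by `≤ ε`:

* `exists_matching` : there is `π` sending every site `s` of the ball to a particle `π s ∈ X` with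
  `dist (π s) s ≤ ε`, injectively in `s`;
* `matching_surjOn` : every particle of the slightly smaller ball `dist · c ≤ r − ε` is `π s` for a site
  `s` of the ball;
* `eq_matching_of_dist_le` : a particle within `ε` of a site of the ball IS the matched particle.

So the displacement `u s := π s − s` (`‖u‖ ≤ ε`) is well defined on the sites of the ball, which is how
the informal proofs ("harmonic approximation of the displacement field") start.  The two halves of the
route's `Near` predicate are taken as separate hypotheses (`hX`, `hS`) so that the lemmas apply verbatim
inside `ExcessDecay`, `HcpLiouville`, `GrainsGlue`.  All `[folklore]`; nothing here closes an item.
-/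

noncomputable section

namespace Summit.AtomisticToContinuum.Crystallization.Theorems.ExcessDecayLiouville

open scoped BigOperators Topology
open Literature.MathematicalPhysics.StatisticalMechanics
open Summit.AtomisticToContinuum.Crystallization.Theorems.PhononStabilityNegative

section Matching

variable {X : Set (EuclideanSpace ℝ (Fin 3))} {c : (EuclideanSpace ℝ (Fin 3))} {r δ ε : ℝ} {t : Fin 2 → (EuclideanSpace ℝ (Fin 3))} {A : (EuclideanSpace ℝ (Fin 3)) →L[ℝ] (EuclideanSpace ℝ (Fin 3))}

/-- **The matching map.**  If every site of the ball `dist · c ≤ r` is within `ε` of a point of the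
`δ`-separated set `X` and `ε < 23/50`, there is a map `π` with `π s ∈ X`, `dist (π s) s ≤ ε` for every
site `s` of the ball, injective on those sites (distinct sites are `≥ 23/25 > 2ε` apart). [folklore] -/
theorem exists_matching (hA : Adm₀ A) (hI : Inner₀ t A) (hε : ε < 23 / 50)
    (hS : ∀ m : Fin 2, ∀ z ∈ Λ₀, dist (t m + A z) c ≤ r → ∃ p ∈ X, dist p (t m + A z) ≤ ε) :
    ∃ π : (EuclideanSpace ℝ (Fin 3)) → (EuclideanSpace ℝ (Fin 3)), (∀ s ∈ Sites₀ t A, dist s c ≤ r → π s ∈ X ∧ dist (π s) s ≤ ε) ∧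
      ∀ s ∈ Sites₀ t A, ∀ s' ∈ Sites₀ t A, dist s c ≤ r → dist s' c ≤ r → π s = π s' → s = s' := by
  classical
  have key : ∀ s : (EuclideanSpace ℝ (Fin 3)), ∃ p : (EuclideanSpace ℝ (Fin 3)), (s ∈ Sites₀ t A ∧ dist s c ≤ r) → p ∈ X ∧ dist p s ≤ ε := by
    intro s
    by_cases h : s ∈ Sites₀ t A ∧ dist s c ≤ r
    · obtain ⟨⟨m, z, hz, rfl⟩, hsc⟩ := h
      obtain ⟨p, hp, hps⟩ := hS m z hz hsc
      exact ⟨p, fun _ => ⟨hp, hps⟩⟩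
    · exact ⟨s, fun h' => absurd h' h⟩
  choose π hπ using key
  refine ⟨π, fun s hs hsc => hπ s ⟨hs, hsc⟩, fun s hs s' hs' hsc hs'c heq => ?_⟩
  have h1 := (hπ s ⟨hs, hsc⟩).2
  have h2 := (hπ s' ⟨hs', hs'c⟩).2
  rw [heq] at h1
  exact site_unique hA hI hε hs hs' h1 h2

/-- **A particle within `ε` of a site of the ball is the matched particle** (`2ε < δ`). [folklore] -/
theorem eq_matching_of_dist_le (hsep : ∀ p ∈ X, ∀ q ∈ X, p ≠ q → δ ≤ dist p q) (hε : 2 * ε < δ)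
    {π : (EuclideanSpace ℝ (Fin 3)) → (EuclideanSpace ℝ (Fin 3))} (hπ : ∀ s ∈ Sites₀ t A, dist s c ≤ r → π s ∈ X ∧ dist (π s) s ≤ ε)
    {p s : (EuclideanSpace ℝ (Fin 3))} (hp : p ∈ X) (hs : s ∈ Sites₀ t A) (hsc : dist s c ≤ r) (hps : dist p s ≤ ε) :
    p = π s :=
  particle_unique hsep hε hp (hπ s hs hsc).1 hps (hπ s hs hsc).2

/-- **The matching is onto the particles of the smaller ball.**  If moreover every particle of the ball
is within `ε` of some site and `0 ≤ 2ε < δ`, then every `p ∈ X` with `dist p c ≤ r − ε` is `π s` for a site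
`s` of the ball `dist · c ≤ r`. [folklore] -/
theorem matching_surjOn (hsep : ∀ p ∈ X, ∀ q ∈ X, p ≠ q → δ ≤ dist p q) (hε0 : 0 ≤ ε)
    (hε : 2 * ε < δ) (hX : ∀ p ∈ X, dist p c ≤ r → ∃ m : Fin 2, ∃ z ∈ Λ₀, dist p (t m + A z) ≤ ε)
    {π : (EuclideanSpace ℝ (Fin 3)) → (EuclideanSpace ℝ (Fin 3))} (hπ : ∀ s ∈ Sites₀ t A, dist s c ≤ r → π s ∈ X ∧ dist (π s) s ≤ ε)
    {p : (EuclideanSpace ℝ (Fin 3))} (hp : p ∈ X) (hpc : dist p c ≤ r - ε) :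
    ∃ s ∈ Sites₀ t A, dist s c ≤ r ∧ π s = p := by
  have hpc' : dist p c ≤ r := by linarith
  obtain ⟨m, z, hz, hd⟩ := hX p hp hpc'
  have hs : t m + A z ∈ Sites₀ t A := ⟨m, z, hz, rfl⟩
  have hsc : dist (t m + A z) c ≤ r := by
    have := dist_triangle (t m + A z) p c
    rw [dist_comm (t m + A z) p] at this
    linarith
  exact ⟨t m + A z, hs, hsc, (eq_matching_of_dist_le hsep hε hπ hp hs hsc hd).symm⟩

/-- **Displacement bound**: the matched particle of a site of the ball is within `ε` of it, i.e. the
displacement `u s = π s − s` has norm `≤ ε`. [folklore] -/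
theorem norm_matching_sub_le {π : (EuclideanSpace ℝ (Fin 3)) → (EuclideanSpace ℝ (Fin 3))}
    (hπ : ∀ s ∈ Sites₀ t A, dist s c ≤ r → π s ∈ X ∧ dist (π s) s ≤ ε)
    {s : (EuclideanSpace ℝ (Fin 3))} (hs : s ∈ Sites₀ t A) (hsc : dist s c ≤ r) : ‖π s - s‖ ≤ ε := by
  rw [← dist_eq_norm]; exact (hπ s hs hsc).2

end Matching

end Summit.AtomisticToContinuum.Crystallization.Theorems.ExcessDecayLiouville

end
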